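import Summits.CriticalPhenomena.PercolationContinuityZ3.Theorems.PercNearOneGluingNoHeavyLowerTailNineTypeKernels

/-!
# `Q44b` packings for ALL finite weighted graphs: `T1 + T2 ≤ P(AC)·P(∅)` and `T1 + T2(3,4,6) + T3 ≤ P(AC)·P(∅)`

Support file for crux `stmt-CriticalPhenomena-4575` (master-family programme, quadratic four-point row `Q44b`),
seat `prim-l12-p6` gen 10.  No named facts, no sorries.

The nine `Q44b` bad (heavy, light) cell pairs of the four marked points `a b c y` are, by type,
`1 (ab|cy, ac|by)  2 (ab|cy, ay|bc)  3 (ab|c|y, ac|by)  4 (ab|c|y, ay|bc)  5 (ab|c|y, a|b|cy)  6 (ab|c|y, acy|b)  7 (ab|c|y, a|bcy)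
 8 (a|bcy, ac|b|y)  9 (a|bcy, ay|b|c)`, and `Q44b` itself is `Σ_{all nine} P(h)·P(l) ≤ [P(ab|cy)+P(abcy)]·P(a|b|c|y)`
(open ∀n).  Combining the abstract all-H theorems of `prim-bnk-1` gen 16–17 (`NineType.allH_card_le`: no `{5,7} × {8,9}`
clash) with the two-copy fibre bridge (`TwoCopyMono.sum_kernel_cell_nonneg`, `TwoCopyMono.goodKernel_kerS`) gives, for EVERY
finite weighted graph `(Fin n, w)` and all marked points (`cell = FourPointAtoms.cell w a b c y`, indices of `pat4`:
`0 a|b|c|y, 1 a|b|cy, 4 ay|b|c, 5 ac|b|y, 6 ab|c|y, 7 a|bcy, 8 ay|bc, 9 ac|by, 10 acy|b, 11 ab|cy, 14 abcy`):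
* `q44b_pack_low` (types 1–7, = gen 16 §9 'T1+T2'):
  `cell 11·(cell 9 + cell 8) + cell 6·(cell 9 + cell 8 + cell 1 + cell 10 + cell 7) ≤ (cell 11 + cell 14)·cell 0`;
* `q44b_pack_anchor` (types 1,2,3,4,6,8,9, = gen 17 §1 'T1+T2(3,4,6)+T3'):
  `cell 11·(cell 9 + cell 8) + cell 6·(cell 9 + cell 8 + cell 10) + cell 7·(cell 5 + cell 4) ≤ (cell 11 + cell 14)·cell 0`;
* the general form `q44b_pack_of_noClash` for any clash-free type set.
The residual of `Q44b` ∀n is exactly the `{5,7} × {8,9}` interaction (rule R7 of gen 17; conjectures R / R_abs).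
-/

noncomputable section

namespace Summit.CriticalPhenomena.PercolationContinuityZ3.Theorems

namespace TwoCopyMono

open Finset FourPointAtoms

variable {n : ℕ}

/-- Evaluation of the nine-type kernel form: `Σ_{i,j} kerS S i j·cᵢ·cⱼ = (c₁₁ + c₁₄)·c₀ − Σ_{θ∈S} c_{h θ}·c_{l θ}`. [this work] -/
theorem sum_kerS_cell (S : Finset ℕ) (hS : ∀ θ ∈ S, 1 ≤ θ ∧ θ ≤ 9) (c : Fin 15 → ℝ) :
    (∑ i : Fin 15, ∑ j : Fin 15, (kerS S i j : ℝ) * c i * c j) =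
      (c 11 + c 14) * c 0 - ∑ θ ∈ S, c (hIdx θ) * c (lIdx θ) := by
  classical
  have hsplit : ∀ i j : Fin 15, (kerS S i j : ℝ) * c i * c j =
      (if isAC i ∧ j = 0 then c i * c j else 0) - (if badS S i j then c i * c j else 0) := by
    intro i j; unfold kerS; push_cast; split_ifs <;> ring
  simp_rw [hsplit, Finset.sum_sub_distrib]
  congr 1
  · -- good part
    have h0 : ∀ i : Fin 15, (∑ j : Fin 15, if isAC i ∧ j = 0 then c i * c j else 0) = if isAC i then c i * c 0 else 0 := by
      intro i
      by_cases hi : isAC i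
      · rw [if_pos hi, Finset.sum_eq_single (0 : Fin 15)]
        · rw [if_pos ⟨hi, rfl⟩]
        · intro j _ hj; rw [if_neg]; rintro ⟨_, h⟩; exact hj h
        · intro h; exact absurd (Finset.mem_univ _) h
      · rw [if_neg hi]; exact Finset.sum_eq_zero fun j _ => by rw [if_neg]; rintro ⟨h, _⟩; exact hi h
    simp_rw [h0]
    rw [Finset.sum_ite, Finset.sum_const_zero, add_zero]
    have hf : (Finset.univ.filter fun i : Fin 15 => isAC i) = {11, 14} := by decide
    rw [hf, Finset.sum_pair (by decide)]; ring
  · -- bad part: reindex by the type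
    have hinj : Set.InjOn (fun θ => (hIdx θ, lIdx θ)) (S : Set ℕ) := by
      intro θ hθ θ' hθ' h
      simp only [Prod.mk.injEq] at h
      exact type_unique θ (Finset.mem_Icc.2 (hS θ hθ)) θ' (Finset.mem_Icc.2 (hS θ' hθ')) h.1 h.2
    rw [← Finset.sum_image (f := fun p : Fin 15 × Fin 15 => c p.1 * c p.2) hinj]
    rw [← Finset.sum_product' (f := fun i j => if badS S i j then c i * c j else 0)]
    rw [← Finset.sum_filter]
    congr 1
    ext p
    simp only [Finset.mem_filter, Finset.mem_product, Finset.mem_univ, true_and, Finset.mem_image, badS]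
    constructor
    · rintro ⟨θ, hθ, h1, h2⟩; exact ⟨θ, hθ, Prod.ext h1 h2⟩
    · rintro ⟨θ, hθ, h⟩; exact ⟨θ, hθ, (congrArg Prod.fst h), (congrArg Prod.snd h)⟩

/-- **General clash-free packing.**  For every type set `S ⊆ {1,…,9}` avoiding the `{5,7} × {8,9}` clash, every finite weighted
graph and all marked points: `Σ_{θ ∈ S} cell(h θ)·cell(l θ) ≤ (cell(ab|cy) + cell(abcy))·cell(a|b|c|y)`. [this work] -/
theorem q44b_pack_of_noClash (S : Finset ℕ) (hS : ∀ θ ∈ S, 1 ≤ θ ∧ θ ≤ 9)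
    (hclash : ¬ ((5 ∈ S ∨ 7 ∈ S) ∧ (8 ∈ S ∨ 9 ∈ S)))
    (w : Sym2 (Fin n) → unitInterval) (a b c y : Fin n) :
    ∑ θ ∈ S, cell w a b c y (hIdx θ) * cell w a b c y (lIdx θ) ≤
      (cell w a b c y 11 + cell w a b c y 14) * cell w a b c y 0 := by
  have h := sum_kernel_cell_nonneg (goodKernel_kerS S hS hclash) w a b c y
  rw [sum_kerS_cell S hS] at h
  linarith

/-- **`T1 + T2 ≤ P(AC)·P(∅)` for every finite weighted graph** (types `1,…,7`; `prim-bnk-1` gen 16 §9 at law level):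
`P(ab|cy)[P(ac|by)+P(ay|bc)] + P(ab|c|y)[P(ac|by)+P(ay|bc)+P(a|b|cy)+P(acy|b)+P(a|bcy)] ≤ [P(ab|cy)+P(abcy)]·P(a|b|c|y)`.
[this work] -/
theorem q44b_pack_low (w : Sym2 (Fin n) → unitInterval) (a b c y : Fin n) :
    cell w a b c y 11 * (cell w a b c y 9 + cell w a b c y 8) +
      cell w a b c y 6 * (cell w a b c y 9 + cell w a b c y 8 + cell w a b c y 1 + cell w a b c y 10 + cell w a b c y 7) ≤
      (cell w a b c y 11 + cell w a b c y 14) * cell w a b c y 0 := by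
  have h := q44b_pack_of_noClash ({1, 2, 3, 4, 5, 6, 7} : Finset ℕ) (by decide) (by decide) w a b c y
  have he : (∑ θ ∈ ({1, 2, 3, 4, 5, 6, 7} : Finset ℕ), cell w a b c y (hIdx θ) * cell w a b c y (lIdx θ)) =
      cell w a b c y 11 * (cell w a b c y 9 + cell w a b c y 8) +
      cell w a b c y 6 * (cell w a b c y 9 + cell w a b c y 8 + cell w a b c y 1 + cell w a b c y 10 + cell w a b c y 7) := by
    rw [Finset.sum_insert (by decide), Finset.sum_insert (by decide), Finset.sum_insert (by decide), Finset.sum_insert (by decide),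
      Finset.sum_insert (by decide), Finset.sum_insert (by decide), Finset.sum_singleton]
    simp only [hIdx, lIdx]
    norm_num
    ring
  linarith

/-- **`T1 + T2(3,4,6) + T3 ≤ P(AC)·P(∅)` for every finite weighted graph** (types `1,2,3,4,6,8,9`; `prim-bnk-1` gen 17 anchor
lemma at law level): `P(ab|cy)[P(ac|by)+P(ay|bc)] + P(ab|c|y)[P(ac|by)+P(ay|bc)+P(acy|b)] + P(a|bcy)[P(ac|b|y)+P(ay|b|c)]
≤ [P(ab|cy)+P(abcy)]·P(a|b|c|y)`. [this work] -/
theorem q44b_pack_anchor (w : Sym2 (Fin n) → unitInterval) (a b c y : Fin n) :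
    cell w a b c y 11 * (cell w a b c y 9 + cell w a b c y 8) +
      cell w a b c y 6 * (cell w a b c y 9 + cell w a b c y 8 + cell w a b c y 10) +
      cell w a b c y 7 * (cell w a b c y 5 + cell w a b c y 4) ≤
      (cell w a b c y 11 + cell w a b c y 14) * cell w a b c y 0 := by
  have h := q44b_pack_of_noClash ({1, 2, 3, 4, 6, 8, 9} : Finset ℕ) (by decide) (by decide) w a b c y
  have he : (∑ θ ∈ ({1, 2, 3, 4, 6, 8, 9} : Finset ℕ), cell w a b c y (hIdx θ) * cell w a b c y (lIdx θ)) =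
      cell w a b c y 11 * (cell w a b c y 9 + cell w a b c y 8) +
      cell w a b c y 6 * (cell w a b c y 9 + cell w a b c y 8 + cell w a b c y 10) +
      cell w a b c y 7 * (cell w a b c y 5 + cell w a b c y 4) := by
    rw [Finset.sum_insert (by decide), Finset.sum_insert (by decide), Finset.sum_insert (by decide), Finset.sum_insert (by decide),
      Finset.sum_insert (by decide), Finset.sum_insert (by decide), Finset.sum_singleton]
    simp only [hIdx, lIdx]
    norm_num
    ring
  linarith

end TwoCopyMono

end Summit.CriticalPhenomena.PercolationContinuityZ3.Theorems

end
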